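import Mathlib
import HarnessLib
import Summits.NavierStokesRegularity.NavierStokesRegularity.Theorems.UnthreadedDoorNetFluxStratumWindowDecay
import Summits.NavierStokesRegularity.NavierStokesRegularity.Theorems.UnthreadedDoorNetFluxOneSidedLawOffNull
import Summits.NavierStokesRegularity.NavierStokesRegularity.Theorems.UnthreadedDoorNetFluxCumulativeFluxLipschitz
import Summits.NavierStokesRegularity.NavierStokesRegularity.Theorems.UnthreadedDoorNetFluxHalfLineOUOffNull
import Summits.NavierStokesRegularity.NavierStokesRegularity.Theorems.UnthreadedDoorNetFluxViscosityStepAt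

/-!
# Route `UnthreadedDoor`, crux `PoloidalLiouville` (stmt-NavierStokesRegularity-1222), WALL W1 — crux idea «null-time», AE-4′:
# window decay of the cumulative net flux OFF A CLOSED NULL SET OF TIMES

`netFluxWindowDecayOffNull` = the body of `NullTime.NetFluxWindowDecayOffNull` (`∀ D, IsClosed D → volume D = 0 →
NetFluxWindowDecayOn (offNullPred D)`, sketch v1.1) VERBATIM with `offNullPred`/`analyticFinitePred`/`sphCrit` unfolded: the (S⁺)
window decay `∫₀ᴿ netFlux(T t) ≤ A C₁ (1 + R/√(−t))³ (t/t₁)^λ` for Type-I unthreaded data whose height-head stratum condition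
(analytic slices, dense finite-zero radii) is known only at the window times OUTSIDE a closed Lebesgue-null set `D`.
Proof = qj-p1's p678535 `netFluxWindowDecayOn_of_laws` (itself ARM A g3's p669139) re-run with: the one-sided law from AE-1
`oneSidedLawOffNull` (p686638; conjunct 4 only at `t ∉ D`), the comparison from AE-2′ `halfLineOU_decay_viscosity_offNull` (p687414)
with the exceptional self-similar times `D' = {s | −e^{−s} ∈ D}` (closed: continuous preimage; null: `D'` is the image of `D ∩ (−∞,0)`
under the `C¹` map `t ↦ −log(−t)`, `addHaar_image_eq_zero_of_differentiableOn_of_addHaar_eq_zero`), its touching-time hypothesis from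
`viscosity_inequality_window_at` (p687801), and its `s`-Lipschitz hypothesis from AE-3 `cumulativeFluxLipschitz` (p686120) + the Type-I
density bound (moving upper limit `ρ e^{−s/2}`).  HONEST: Type-I-side tooling under crux 1222 (OPEN); W1 movement 0; NS regularity NOT
proved.  `--supports stmt-NavierStokesRegularity-1222 --as helper`.  [folklore]
-/

-- the summit and its single sub-problem share the name (CONVENTIONS §1)
set_option linter.dupNamespace false

noncomputable section

open Set Function Filter Topology MeasureTheory intervalIntegral
open scoped Topology

namespace Summit.NavierStokesRegularity.NavierStokesRegularity.Theorems.PoloidalLiouville.NetFlux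

open Literature.Analysis Literature.Analysis.FluidPDE

/-- `|e^{−s} − e^{−s′}| ≤ e^{−a}|s − s′|` for `s, s′ ≥ a`. [folklore] -/
theorem abs_exp_neg_sub_le {a s s' : ℝ} (hs : a ≤ s) (hs' : a ≤ s') :
    |Real.exp (-s) - Real.exp (-s')| ≤ Real.exp (-a) * |s - s'| := by
  wlog h : s ≤ s' generalizing s s'
  · have := this hs' hs (not_le.1 h).le
    rwa [abs_sub_comm, abs_sub_comm s' s] at this
  have h1 := exp_decay_sub_le (lam := 1) (s₁ := a) (σ' := s) (σ := s') one_pos hs h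
  have e1 : Real.exp (-s) = Real.exp (-a) * Real.exp (-1 * (s - a)) := by
    rw [← Real.exp_add]; congr 1; ring
  have e2 : Real.exp (-s') = Real.exp (-a) * Real.exp (-1 * (s' - a)) := by
    rw [← Real.exp_add]; congr 1; ring
  have hnn : 0 ≤ Real.exp (-s) - Real.exp (-s') := by
    have := Real.exp_le_exp.2 (neg_le_neg h); linarith
  rw [abs_of_nonneg hnn, abs_of_nonpos (by linarith : s - s' ≤ 0), e1, e2, ← mul_sub]
  have hpos : 0 ≤ Real.exp (-a) := (Real.exp_pos _).le
  calc Real.exp (-a) * (Real.exp (-1 * (s - a)) - Real.exp (-1 * (s' - a)))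
      ≤ Real.exp (-a) * (1 * (s' - s)) := mul_le_mul_of_nonneg_left h1 hpos
    _ = Real.exp (-a) * -(s - s') := by ring

/-- `|e^{−s/2} − e^{−s′/2}| ≤ e^{−a/2}|s − s′|` for `s, s′ ≥ a`. [folklore] -/
theorem abs_exp_neg_half_sub_le {a s s' : ℝ} (hs : a ≤ s) (hs' : a ≤ s') :
    |Real.exp (-s / 2) - Real.exp (-s' / 2)| ≤ Real.exp (-a / 2) * |s - s'| := by
  wlog h : s ≤ s' generalizing s s'
  · have := this hs' hs (not_le.1 h).le
    rwa [abs_sub_comm, abs_sub_comm s' s] at this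
  have h1 := exp_decay_sub_le (lam := 1 / 2) (s₁ := a) (σ' := s) (σ := s') (by norm_num) hs h
  have e1 : Real.exp (-s / 2) = Real.exp (-a / 2) * Real.exp (-(1 / 2) * (s - a)) := by
    rw [← Real.exp_add]; congr 1; ring
  have e2 : Real.exp (-s' / 2) = Real.exp (-a / 2) * Real.exp (-(1 / 2) * (s' - a)) := by
    rw [← Real.exp_add]; congr 1; ring
  have hnn : 0 ≤ Real.exp (-s / 2) - Real.exp (-s' / 2) := by
    have := Real.exp_le_exp.2 (show -s' / 2 ≤ -s / 2 by linarith); linarith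
  rw [abs_of_nonneg hnn, abs_of_nonpos (by linarith : s - s' ≤ 0), e1, e2, ← mul_sub]
  have hpos : 0 ≤ Real.exp (-a / 2) := (Real.exp_pos _).le
  have h2 : 1 / 2 * (s' - s) ≤ -(s - s') := by linarith
  calc Real.exp (-a / 2) * (Real.exp (-(1 / 2) * (s - a)) - Real.exp (-(1 / 2) * (s' - a)))
      ≤ Real.exp (-a / 2) * (1 / 2 * (s' - s)) := mul_le_mul_of_nonneg_left h1 hpos
    _ ≤ Real.exp (-a / 2) * -(s - s') := mul_le_mul_of_nonneg_left h2 hpos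

/-- **AE-4′ `NullTime.NetFluxWindowDecayOffNull`, binders VERBATIM (Props unfolded): window decay of the cumulative net flux when the
height-head stratum condition holds only off a closed null set of times.** [folklore] -/
theorem netFluxWindowDecayOffNull : ∀ D : Set ℝ, IsClosed D → volume D = 0 →
    ∀ C : ℝ, 0 ≤ C → ∃ lam > (0 : ℝ), ∃ A : ℝ,
      ∀ (v : ℝ → E3 → E3) (x₀ : E3) (T : ℝ → E3 → ℝ) (C₁ t₀ : ℝ), t₀ < 0 →
      ContDiffOn ℝ (⊤ : ℕ∞) (uncurry v) (Ioo t₀ 0 ×ˢ univ) →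
      ContDiffOn ℝ (⊤ : ℕ∞) (uncurry T) (Ioo t₀ 0 ×ˢ ({x₀}ᶜ : Set E3)) →
      (∀ t ∈ Ioo t₀ 0, ∀ x, ‖v t x‖ ≤ C / Real.sqrt (-t)) →
      (∀ t ∈ Ioo t₀ 0, ∀ x, ‖curl (v t) x‖ ≤ C₁ / (-t)) →
      (∀ t ∈ Ioo t₀ 0, ∀ x, curl (v t) x = cross (gradient (T t) x) (x - x₀)) →
      CurledLaw v x₀ T (Ioo t₀ 0) →
      (∀ t ∈ Ioo t₀ 0, t ∉ D →
        AnalyticOnNhd ℝ (v t) (univ : Set E3) ∧ AnalyticOnNhd ℝ (T t) ({x₀}ᶜ : Set E3) ∧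
          Ioi (0 : ℝ) ⊆ closure {r : ℝ | 0 < r ∧
            {x : E3 | x ∈ Metric.sphere x₀ r ∧ cross (gradient (T t) x) (x - x₀) = 0}.Finite}) →
      ∀ t₁ t R : ℝ, t₀ < t₁ → t₁ ≤ t → t < 0 → 0 < R →
        ∫ r in Ioo 0 R, netFlux (T t) x₀ r
          ≤ A * C₁ * (1 + R / Real.sqrt (-t)) ^ 3 * (t / t₁) ^ lam := by
  intro D hD hD0 C hC
  obtain ⟨lam, hlam, A, hOU⟩ := halfLineOU_decay_viscosity_offNull C hC
  refine ⟨lam, hlam, A * (Real.pi / 2), ?_⟩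
  intro v x₀ T C₁ t₀ ht₀ hv hT hvC hωC hlink hlaw hS t₁ t R ht₁ ht₁t ht hR
  -- time slices of the data
  have hvs : ∀ t' ∈ Ioo t₀ 0, ContDiff ℝ 1 (v t') := fun t' ht' => by
    have h : ContDiffOn ℝ (⊤ : ℕ∞) (uncurry v ∘ fun x : E3 => (t', x)) univ :=
      hv.comp ((contDiff_prodMk_right t').contDiffOn (s := univ)) (fun x _ => ⟨ht', mem_univ x⟩)
    have h2 : ContDiff ℝ (⊤ : ℕ∞) (v t') := contDiffOn_univ.1 h
    exact h2.of_le (by exact_mod_cast le_top)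
  have hTs : ∀ t' ∈ Ioo t₀ 0, ContDiffOn ℝ 1 (T t') ({x₀}ᶜ : Set E3) := fun t' ht' => by
    have h : ContDiffOn ℝ (⊤ : ℕ∞) (uncurry T ∘ fun x : E3 => (t', x)) ({x₀}ᶜ : Set E3) :=
      hT.comp ((contDiff_prodMk_right t').contDiffOn (s := ({x₀}ᶜ : Set E3))) (fun x hx => ⟨ht', hx⟩)
    exact h.of_le (by exact_mod_cast le_top)
  -- `0 ≤ C₁`
  have ht₁mem : t₁ ∈ Ioo t₀ 0 := ⟨ht₁, lt_of_le_of_lt ht₁t ht⟩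
  have hC₁ : 0 ≤ C₁ := by
    have h0 : (0:ℝ) ≤ C₁ / (-t₁) := le_trans (norm_nonneg _) (hωC t₁ ht₁mem x₀)
    have hnt : 0 < -t₁ := by linarith [ht₁mem.2]
    by_contra hneg
    push Not at hneg
    have : C₁ / (-t₁) < 0 := div_neg_of_neg_of_pos hneg hnt
    linarith
  -- (1) the a-priori bound on the net flux density
  have hbd : ∀ t' ∈ Ioo t₀ 0, ∀ r, 0 < r →
      0 ≤ netFlux (T t') x₀ r ∧ netFlux (T t') x₀ r ≤ Real.pi * C₁ * r / (-t') := by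
    intro t' ht' r hr
    have hnt : 0 < -t' := by linarith [ht'.2]
    have hosc : sphOsc (T t') x₀ r ≤ Real.pi * (C₁ / (-t')) :=
      oscLeVorticity (v t') x₀ (T t') r (C₁ / (-t')) hr (hvs t' ht') (hTs t' ht') (hlink t' ht') (fun x _ => hωC t' ht' x)
    have hosc0 : 0 ≤ sphOsc (T t') x₀ r := sphOsc_nonneg_offCentre (hTs t' ht').continuousOn hr
    refine ⟨mul_nonneg hr.le hosc0, ?_⟩
    calc netFlux (T t') x₀ r = r * sphOsc (T t') x₀ r := rfl
      _ ≤ r * (Real.pi * (C₁ / (-t'))) := mul_le_mul_of_nonneg_left hosc hr.le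
      _ = Real.pi * C₁ * r / (-t') := by field_simp
  -- (L) and (NC) for these data
  obtain ⟨ℓp, ℓm, hcont, hℓp, hℓm, hlawL⟩ :=
    oneSidedLawOffNull D hD v x₀ T (fun s => C / Real.sqrt (-s)) t₀ hv hT hvC hlaw hS
  have hnc : ∀ t₁' t₂' : ℝ, t₀ < t₁' → t₁' ≤ t₂' → t₂' < 0 → ∃ κ : ℝ, 0 ≤ κ ∧ ∀ a₀ : ℝ, 0 < a₀ → a₀ ≤ 1 →
      (∀ t' ∈ Icc t₁' t₂', (∀ a ∈ Ioo 0 a₀, netFlux (T t') x₀ a ≤ κ * a ^ 2) ∧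
        LipschitzOnWith (Real.toNNReal (κ * a₀)) (fun r => netFlux (T t') x₀ r) (Ioo 0 a₀)) ∧
      (∀ t' ∈ Icc t₁' t₂', ∀ t'' ∈ Icc t₁' t₂', ∀ a ∈ Ioo 0 a₀,
        |netFlux (T t') x₀ a - netFlux (T t'') x₀ a| ≤ κ * a ^ 2 * |t' - t''|) :=
    fun t₁' t₂' h1 h2 h3 => nearCentreFlux v x₀ T t₀ t₁' t₂' h1 h2 h3 hv hT hlink
  -- (2) the self-similar cumulative flux `U`
  set s₁ : ℝ := -Real.log (-t₁) with hs₁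
  have hnt₁ : 0 < -t₁ := by linarith [ht₁mem.2]
  have hτs₁ : -Real.exp (-s₁) = t₁ := by rw [hs₁, neg_neg, Real.exp_log hnt₁, neg_neg]
  have hτ : ∀ s, s₁ ≤ s → -Real.exp (-s) ∈ Ioo t₀ 0 := fun s hs => by
    refine ⟨?_, neg_neg_of_pos (Real.exp_pos _)⟩
    have h1 : Real.exp (-s) ≤ Real.exp (-s₁) := Real.exp_le_exp.2 (by linarith)
    linarith [hτs₁]
  obtain ⟨U, hU⟩ : ∃ U : ℝ → ℝ → ℝ, ∀ s ρ,
      U s ρ = ∫ r in (0:ℝ)..(ρ * Real.exp (-s / 2)), netFlux (T (-Real.exp (-s))) x₀ r :=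
    ⟨fun s ρ => ∫ r in (0:ℝ)..(ρ * Real.exp (-s / 2)), netFlux (T (-Real.exp (-s))) x₀ r, fun _ _ => rfl⟩
  have hW := continuousOn_window_primitive (w := fun t' r => netFlux (T t') x₀ r) (t₀ := t₀) (K := Real.pi * C₁)
    hcont hbd
  have hUcont : ContinuousOn (uncurry U) (Ici s₁ ×ˢ Ici 0) := by
    have hmap : Continuous (fun q : ℝ × ℝ => ((-Real.exp (-q.1), q.2 * Real.exp (-q.1 / 2)) : ℝ × ℝ)) := by
      fun_prop
    have hmaps : MapsTo (fun q : ℝ × ℝ => ((-Real.exp (-q.1), q.2 * Real.exp (-q.1 / 2)) : ℝ × ℝ))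
        (Ici s₁ ×ˢ Ici 0) (Ioo t₀ 0 ×ˢ Ici 0) :=
      fun q hq => ⟨hτ q.1 hq.1, mul_nonneg hq.2 (Real.exp_pos _).le⟩
    have hcomp := hW.comp hmap.continuousOn hmaps
    have heq : uncurry U = (fun p : ℝ × ℝ => ∫ r in (0:ℝ)..p.2, netFlux (T p.1) x₀ r) ∘
        (fun q : ℝ × ℝ => ((-Real.exp (-q.1), q.2 * Real.exp (-q.1 / 2)) : ℝ × ℝ)) := by
      funext q
      simp only [Function.comp_apply, Function.uncurry_def]
      rw [hU]
    rw [heq]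
    exact hcomp
  have hU0 : ∀ s, s₁ ≤ s → U s 0 ≤ 0 := fun s _ => by rw [hU]; simp
  have hUgr : ∀ s, s₁ ≤ s → ∀ ρ, 0 ≤ ρ → U s ρ ≤ Real.pi / 2 * C₁ * (1 + ρ) ^ 3 := by
    intro s hs ρ hρ
    rw [hU]
    have hb := window_primitive_le (w := fun t' r => netFlux (T t') x₀ r) (t₀ := t₀) (K := Real.pi * C₁)
      hcont hbd (hτ s hs) (R := ρ * Real.exp (-s / 2)) (mul_nonneg hρ (Real.exp_pos _).le)
    have he : Real.exp (-s / 2) ^ 2 = Real.exp (-s) := by rw [sq, ← Real.exp_add]; ring_nf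
    have hval : Real.pi * C₁ / -(-Real.exp (-s)) * (ρ * Real.exp (-s / 2)) ^ 2 / 2
        = Real.pi / 2 * C₁ * ρ ^ 2 := by
      rw [neg_neg, mul_pow, he]; field_simp
    have hρ3 : ρ ^ 2 ≤ (1 + ρ) ^ 3 := by
      have h3 : 0 ≤ ρ ^ 3 := pow_nonneg hρ 3
      nlinarith [sq_nonneg ρ]
    calc ∫ r in (0:ℝ)..(ρ * Real.exp (-s / 2)), netFlux (T (-Real.exp (-s))) x₀ r
        ≤ Real.pi / 2 * C₁ * ρ ^ 2 := hval ▸ hb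
      _ ≤ Real.pi / 2 * C₁ * (1 + ρ) ^ 3 := mul_le_mul_of_nonneg_left hρ3 (by positivity)
  -- the exceptional set of self-similar times `D' = {s | −e^{−s} ∈ D}`: closed and null
  set D' : Set ℝ := {σ : ℝ | -Real.exp (-σ) ∈ D} with hD'
  have hD'c : IsClosed D' := hD.preimage (by fun_prop)
  have hD'0 : volume D' = 0 := by
    have hsub : D' ⊆ (fun t : ℝ => -Real.log (-t)) '' (D ∩ Iio 0) := by
      intro σ hσ
      refine ⟨-Real.exp (-σ), ⟨hσ, neg_neg_of_pos (Real.exp_pos _)⟩, ?_⟩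
      show -Real.log (-(-Real.exp (-σ))) = σ
      rw [neg_neg, Real.log_exp, neg_neg]
    have hdiff : DifferentiableOn ℝ (fun t : ℝ => -Real.log (-t)) (D ∩ Iio 0) := by
      intro t ht
      have h0 : -t ≠ 0 := by have := ht.2; rw [mem_Iio] at this; linarith
      exact (((Real.hasDerivAt_log h0).comp t (hasDerivAt_neg t)).neg).differentiableAt.differentiableWithinAt
    have h0 : volume (D ∩ Iio 0) = 0 := measure_mono_null inter_subset_left hD0
    exact measure_mono_null hsub
      (MeasureTheory.addHaar_image_eq_zero_of_differentiableOn_of_addHaar_eq_zero volume hdiff h0)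
  -- `U` is Lipschitz in `s` on `[a,b] × [0,Rρ]`, `s₁ < a` (AE-3 `cumulativeFluxLipschitz` + the Type-I bound on the density)
  have hULip : ∀ a b Rρ : ℝ, s₁ < a → a < b → 0 < Rρ →
      ∃ L : NNReal, ∀ ρ ∈ Icc 0 Rρ, LipschitzOnWith L (fun s => U s ρ) (Icc a b) := by
    intro a b Rρ ha hab hRρ
    -- the physical times of `[a,b]`
    have hτa : t₁ < -Real.exp (-a) := by
      rw [← hτs₁]; have := Real.exp_lt_exp.2 (neg_lt_neg ha); linarith
    have hτab : -Real.exp (-a) < -Real.exp (-b) := by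
      have := Real.exp_lt_exp.2 (neg_lt_neg hab); linarith
    have hτb0 : -Real.exp (-b) < 0 := neg_neg_of_pos (Real.exp_pos _)
    have hτmem : ∀ s ∈ Icc a b, -Real.exp (-s) ∈ Icc (-Real.exp (-a)) (-Real.exp (-b)) := by
      intro s hs
      constructor
      · have := Real.exp_le_exp.2 (neg_le_neg hs.1); linarith
      · have := Real.exp_le_exp.2 (neg_le_neg hs.2); linarith
    set R' : ℝ := Rρ * Real.exp (-a / 2) with hR'
    have hR'0 : 0 < R' := by positivity
    have hρ' : ∀ s ∈ Icc a b, ∀ ρ ∈ Icc (0:ℝ) Rρ, ρ * Real.exp (-s / 2) ∈ Icc 0 R' := by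
      intro s hs ρ hρ
      refine ⟨mul_nonneg hρ.1 (Real.exp_pos _).le, ?_⟩
      have h1 : Real.exp (-s / 2) ≤ Real.exp (-a / 2) := Real.exp_le_exp.2 (by linarith [hs.1])
      calc ρ * Real.exp (-s / 2) ≤ Rρ * Real.exp (-s / 2) := mul_le_mul_of_nonneg_right hρ.2 (Real.exp_pos _).le
        _ ≤ Rρ * Real.exp (-a / 2) := mul_le_mul_of_nonneg_left h1 hRρ.le
    obtain ⟨L₁, hL₁⟩ := cumulativeFluxLipschitz v x₀ T t₀ hv hT hlink (-Real.exp (-a)) (-Real.exp (-b)) R'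
      (ht₁.trans hτa) hτab hτb0 hR'0
    -- sup of the density on `(0, R']` at times `≥ −e^{−a}`
    set M₂ : ℝ := Real.pi * C₁ * R' / Real.exp (-b) with hM₂
    have hM₂0 : 0 ≤ M₂ := by positivity
    have hdens : ∀ s ∈ Icc a b, ∀ r, 0 < r → r ≤ R' → |netFlux (T (-Real.exp (-s))) x₀ r| ≤ M₂ := by
      intro s hs r hr hrR
      have hmem : -Real.exp (-s) ∈ Ioo t₀ 0 := hτ s (ha.le.trans hs.1)
      obtain ⟨h0, h1⟩ := hbd _ hmem r hr
      rw [abs_of_nonneg h0, neg_neg] at *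
      have h2 : Real.exp (-b) ≤ Real.exp (-s) := Real.exp_le_exp.2 (by linarith [hs.2])
      calc netFlux (T (-Real.exp (-s))) x₀ r ≤ Real.pi * C₁ * r / Real.exp (-s) := h1
        _ ≤ Real.pi * C₁ * R' / Real.exp (-s) := by gcongr
        _ ≤ Real.pi * C₁ * R' / Real.exp (-b) := by
            apply div_le_div_of_nonneg_left (by positivity) (Real.exp_pos _) h2
    refine ⟨Real.toNNReal ((L₁ : ℝ) * Real.exp (-a) + M₂ * Rρ * Real.exp (-a / 2)),
      fun ρ hρ => LipschitzOnWith.of_dist_le_mul fun s hs s' hs' => ?_⟩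
    rw [Real.dist_eq, Real.dist_eq, Real.coe_toNNReal _ (by positivity)]
    -- the two upper limits
    set P : ℝ := ρ * Real.exp (-s / 2) with hP
    set P' : ℝ := ρ * Real.exp (-s' / 2) with hP'
    have hP0 : 0 ≤ P := mul_nonneg hρ.1 (Real.exp_pos _).le
    have hP'0 : 0 ≤ P' := mul_nonneg hρ.1 (Real.exp_pos _).le
    have hPR : P ≤ R' := (hρ' s hs ρ hρ).2
    have hP'R : P' ≤ R' := (hρ' s' hs' ρ hρ).2
    have hsplit : U s ρ - U s' ρ
        = ((∫ r in (0:ℝ)..P, netFlux (T (-Real.exp (-s))) x₀ r) - ∫ r in (0:ℝ)..P, netFlux (T (-Real.exp (-s'))) x₀ r)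
          + ((∫ r in (0:ℝ)..P, netFlux (T (-Real.exp (-s'))) x₀ r)
            - ∫ r in (0:ℝ)..P', netFlux (T (-Real.exp (-s'))) x₀ r) := by
      rw [hU, hU]; ring
    -- first difference: AE-3 at the fixed radius `P ≤ R'`
    have hA := (hL₁ P ⟨hP0, hPR⟩).dist_le_mul _ (hτmem s hs) _ (hτmem s' hs')
    simp only [Real.dist_eq] at hA
    rw [setIntegral_Ioo_eq_intervalIntegral _ hP0, setIntegral_Ioo_eq_intervalIntegral _ hP0] at hA
    have hea : |(-Real.exp (-s)) - (-Real.exp (-s'))| ≤ Real.exp (-a) * |s - s'| := by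
      rw [neg_sub_neg, abs_sub_comm]; exact abs_exp_neg_sub_le hs.1 hs'.1
    have h1 : |(∫ r in (0:ℝ)..P, netFlux (T (-Real.exp (-s))) x₀ r) - ∫ r in (0:ℝ)..P, netFlux (T (-Real.exp (-s'))) x₀ r|
        ≤ (L₁ : ℝ) * Real.exp (-a) * |s - s'| := by
      calc _ ≤ (L₁ : ℝ) * |(-Real.exp (-s)) - (-Real.exp (-s'))| := hA
        _ ≤ (L₁ : ℝ) * (Real.exp (-a) * |s - s'|) := mul_le_mul_of_nonneg_left hea L₁.2
        _ = (L₁ : ℝ) * Real.exp (-a) * |s - s'| := by ring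
    -- second difference: moving upper limit, density bounded by `M₂`
    have hlim : |P - P'| ≤ Rρ * Real.exp (-a / 2) * |s - s'| := by
      rw [hP, hP', ← mul_sub, abs_mul, abs_of_nonneg hρ.1]
      calc ρ * |Real.exp (-s / 2) - Real.exp (-s' / 2)| ≤ Rρ * (Real.exp (-a / 2) * |s - s'|) :=
            mul_le_mul hρ.2 (abs_exp_neg_half_sub_le hs.1 hs'.1) (abs_nonneg _) hRρ.le
        _ = Rρ * Real.exp (-a / 2) * |s - s'| := by ring
    have hτs' : -Real.exp (-s') ∈ Ioo t₀ 0 := hτ s' (ha.le.trans hs'.1)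
    have hiP : IntervalIntegrable (fun r => netFlux (T (-Real.exp (-s'))) x₀ r) volume 0 P :=
      window_intervalIntegrable hcont hbd hτs' le_rfl hP0
    have hiP' : IntervalIntegrable (fun r => netFlux (T (-Real.exp (-s'))) x₀ r) volume 0 P' :=
      window_intervalIntegrable hcont hbd hτs' le_rfl hP'0
    have h2 : |(∫ r in (0:ℝ)..P, netFlux (T (-Real.exp (-s'))) x₀ r) - ∫ r in (0:ℝ)..P', netFlux (T (-Real.exp (-s'))) x₀ r|
        ≤ M₂ * (Rρ * Real.exp (-a / 2) * |s - s'|) := by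
      rw [intervalIntegral.integral_interval_sub_left hiP hiP']
      have hb := intervalIntegral.norm_integral_le_of_norm_le_const (a := P') (b := P) (C := M₂)
        (f := fun r => netFlux (T (-Real.exp (-s'))) x₀ r) (fun r hr => by
          have hr0 : 0 < r := by
            rcases mem_uIoc.1 hr with h | h
            · exact lt_of_le_of_lt hP'0 h.1
            · exact lt_of_le_of_lt hP0 h.1
          have hrR : r ≤ R' := by
            rcases mem_uIoc.1 hr with h | h
            · exact h.2.trans hPR
            · exact h.2.trans hP'R
          rw [Real.norm_eq_abs]
          exact hdens s' hs' r hr0 hrR)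
      rw [Real.norm_eq_abs] at hb
      calc _ ≤ M₂ * |P - P'| := hb
        _ ≤ M₂ * (Rρ * Real.exp (-a / 2) * |s - s'|) := mul_le_mul_of_nonneg_left hlim hM₂0
    rw [hsplit]
    calc _ ≤ |(∫ r in (0:ℝ)..P, netFlux (T (-Real.exp (-s))) x₀ r) - ∫ r in (0:ℝ)..P, netFlux (T (-Real.exp (-s'))) x₀ r|
            + |(∫ r in (0:ℝ)..P, netFlux (T (-Real.exp (-s'))) x₀ r)
              - ∫ r in (0:ℝ)..P', netFlux (T (-Real.exp (-s'))) x₀ r| := abs_add_le _ _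
      _ ≤ (L₁ : ℝ) * Real.exp (-a) * |s - s'| + M₂ * (Rρ * Real.exp (-a / 2) * |s - s'|) := add_le_add h1 h2
      _ = ((L₁ : ℝ) * Real.exp (-a) + M₂ * Rρ * Real.exp (-a / 2)) * |s - s'| := by ring
  -- (3) the viscosity inequality and (4) the OU decay BY NAME
  have key := hOU U s₁ (Real.pi / 2 * C₁) D' hD'c hD'0 hUcont hU0 hUgr (by positivity) hULip
    (fun φ φₛ φ₁ φ₂ s₀ ρ₀ hs₀ hρ₀ hs₀D hφs hφ1 hφ2 hmax =>
      viscosity_inequality_window_at (w := fun t' r => netFlux (T t') x₀ r) hC hcont hbd hℓp hℓm hnc hU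
        φ φₛ φ₁ φ₂ s₀ ρ₀ (hτ s₀ hs₀.le).1 hρ₀ (hlawL _ (hτ s₀ hs₀.le) hs₀D) hφs hφ1 hφ2 hmax)
  -- back to `(t, R)`
  have hnt : 0 < -t := by linarith
  set s : ℝ := -Real.log (-t) with hs
  have hss₁ : s₁ ≤ s := by
    rw [hs, hs₁]
    have := Real.log_le_log hnt (by linarith : -t ≤ -t₁)
    linarith
  have hτs : -Real.exp (-s) = t := by rw [hs, neg_neg, Real.exp_log hnt, neg_neg]
  have hsq : Real.exp (-s / 2) = Real.sqrt (-t) := by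
    rw [hs, neg_neg, Real.sqrt_eq_rpow, Real.rpow_def_of_pos hnt]
    congr 1; ring
  have hsqpos : 0 < Real.sqrt (-t) := Real.sqrt_pos.2 hnt
  have hρR : R / Real.sqrt (-t) * Real.exp (-s / 2) = R := by
    rw [hsq]; field_simp
  have hfin := key s hss₁ (R / Real.sqrt (-t)) (div_nonneg hR.le hsqpos.le)
  rw [hU, hρR, hτs] at hfin
  have hexp : Real.exp (-lam * (s - s₁)) = (t / t₁) ^ lam := by
    have hq : 0 < t / t₁ := div_pos_of_neg_of_neg ht (by linarith)
    rw [Real.rpow_def_of_pos hq, hs, hs₁]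
    congr 1
    have : Real.log (t / t₁) = Real.log (-t) - Real.log (-t₁) := by
      rw [← Real.log_div hnt.ne' hnt₁.ne', neg_div_neg_eq]
    rw [this]; ring
  rw [hexp] at hfin
  rw [setIntegral_Ioo_eq_intervalIntegral _ hR.le]
  calc ∫ r in (0:ℝ)..R, netFlux (T t) x₀ r
      ≤ A * (Real.pi / 2 * C₁) * (1 + R / Real.sqrt (-t)) ^ 3 * (t / t₁) ^ lam := hfin
    _ = A * (Real.pi / 2) * C₁ * (1 + R / Real.sqrt (-t)) ^ 3 * (t / t₁) ^ lam := by ring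

end Summit.NavierStokesRegularity.NavierStokesRegularity.Theorems.PoloidalLiouville.NetFlux

end
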